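import Summits.ABC.ABC.Theorems.TwistAmplificationMazurKaneLawRecordFineDefs
import Summits.ABC.ABC.Theorems.TwistAmplificationMazurKaneLawRecordDictionary

-- `Summit.ABC.ABC` is the mandated summit-side namespace (single-conjunct summit); the lakefile sets the same option.
set_option linter.dupNamespace false

/-!
# Crux `TwistAmplification.MazurKaneLaw` (stmt-ABC-2757), line `fibre-toolkit-lp-wall-map`: the J-generic dictionary theorem with
# slack coefficient `K` (record pipeline v2, fine records)

`recordInstanceK_of_lp`: if the pure-real linear programme in `J` explicit levels (the hypothesis telescope of
`recordInstance_of_lp`, verbatim) implies `D ≤ Vc + K·σ`, then `RecordInstanceK K J s₀ Vc`. The proof is that of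
`recordInstance_of_lp` (`…RecordDictionary.lean`) with the last line changed.
-/

noncomputable section

open Finset
open Literature.NumberTheory.DiophantineGeometry
open Literature.NumberTheory.DiophantineGeometry.AbcShapes

namespace Summit.ABC.ABC.Theorems.MazurKaneLaw

open Summit.ABC.ABC.Theorems.MazurKaneLaw.Toolkit

/-- **The J-generic dictionary theorem with slack coefficient `K`** (registered sub-goal `recordInstanceK_of_lp` of crux
stmt-ABC-2757): a proof of the pure-real LP in `J ≥ 1` explicit levels (structure + the five tool families, slack `σ ≤ 1/1000`)
with conclusion `D ≤ Vc + K·σ` yields `RecordInstanceK K J s₀ Vc`. Pattern: `recordInstance_of_lp`. -/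
theorem recordInstanceK_of_lp : ∀ (K : ℝ) (J : ℕ) (s₀ Vc : ℝ), 1 ≤ J →
    (∀ (a b c : Fin J → ℝ) (A B C D da db dc σ : ℝ),
      (∀ k, 0 ≤ a k) → (∀ k, 0 ≤ b k) → (∀ k, 0 ≤ c k) →
      ∑ k, a k ≤ A → ∑ k, b k ≤ B → ∑ k, c k ≤ C →
      ((J : ℝ) + 1) * A - ∑ k : Fin J, ((J : ℝ) - ((k : ℕ) : ℝ)) * a k ≤ 1 - da → 0 ≤ da → da ≤ 1 →
      ((J : ℝ) + 1) * B - ∑ k : Fin J, ((J : ℝ) - ((k : ℕ) : ℝ)) * b k ≤ 1 - db → 0 ≤ db → db ≤ 1 →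
      ((J : ℝ) + 1) * C - ∑ k : Fin J, ((J : ℝ) - ((k : ℕ) : ℝ)) * c k ≤ 1 - dc → 0 ≤ dc → dc ≤ σ →
      0 ≤ σ → σ ≤ 1 / 1000 → A + B + C ≤ s₀ + σ →
      D ≤ A + B + σ → D ≤ A + C + σ → D ≤ B + C + σ →
      (∀ k : Fin J, 1 ≤ (k : ℕ) →
        D ≤ A + B + C - (a k + b k + c k) + σ ∨
        D ≤ A + B + C - 1 + ((((k : ℕ) : ℝ) - 1) * (a k + b k + c k) + (da + db + dc)) / 3 + σ) →
      (∀ (SU SV SW : Finset (Fin J)) (eU eV eW : ℕ), 2 ≤ eU → 2 ≤ eV → 2 ≤ eW →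
        (∀ k ∈ SU, eU ∣ (k : ℕ) + 1) → (∀ k ∈ SV, eV ∣ (k : ℕ) + 1) → (∀ k ∈ SW, eW ∣ (k : ℕ) + 1) →
        ∑ k ∈ SU, a k + ∑ k ∈ SV, b k + ∑ k ∈ SW, c k ≤ 4 * (A + B + C) - 6 * D + σ) →
      (∀ (I J' K : Finset (Fin J)),
        ∑ k ∈ I, a k + ∑ k ∈ J', b k + ∑ k ∈ K, c k ≤ A + B + C - D + σ ∨
        1 - (∑ k ∈ I, ((k : ℕ) : ℝ) * a k + ∑ k ∈ J', ((k : ℕ) : ℝ) * b k + ∑ k ∈ K, ((k : ℕ) : ℝ) * c k) ≤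
          A + B + C - D + σ) →
      (∀ (H : Finset (Fin J)) (k : Fin J), 1 ≤ (k : ℕ) →
        D ≤ A + B + C - (1 - da) + ∑ j ∈ H, ((j : ℕ) : ℝ) * a j + σ ∨
        D ≤ A + B + C - (∑ j ∈ H, a j + b k + c k) + σ) →
      (∀ (H : Finset (Fin J)) (k : Fin J), 1 ≤ (k : ℕ) →
        D ≤ A + B + C - (1 - db) + ∑ j ∈ H, ((j : ℕ) : ℝ) * b j + σ ∨
        D ≤ A + B + C - (∑ j ∈ H, b j + a k + c k) + σ) →
      (∀ (H : Finset (Fin J)) (k : Fin J), 1 ≤ (k : ℕ) →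
        D ≤ A + B + C - (1 - dc) + ∑ j ∈ H, ((j : ℕ) : ℝ) * c j + σ ∨
        D ≤ A + B + C - (∑ j ∈ H, c j + a k + b k) + σ) →
      D ≤ Vc + K * σ) →
    Summit.ABC.ABC.Theorems.MazurKaneLaw.Toolkit.RecordInstanceK K J s₀ Vc := by
  -- adapted from `recordInstance_of_lp` (TwistAmplificationMazurKaneLawRecordDictionary.lean): same proof, extra `K`
  intro K J s₀ Vc hJ hlp e c₁ c₂ c₃ C₀ hc₁ hc₂ hc₃ hC₀ X Y Z hX hY hZ T Dτ hTX hTY hTZ hD hC₀le hvX hvY hvZ t hP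
    hB0 P₀ hP₀ hdet hQX hQZ hσm
  classical
  obtain ⟨Λ, hΛdef⟩ : ∃ Λ : ℝ, Λ = 2 * C₀ := ⟨_, rfl⟩
  rw [← hΛdef] at hP hσm ⊢
  obtain ⟨σ, hσdef⟩ : ∃ σ : ℝ, recordSlack J (J + e) Λ Dτ P₀ t s₀ = σ := ⟨_, rfl⟩
  rw [hσdef] at hσm ⊢
  /- positivity of the scale and of the loss terms; the slack -/
  have hC₀' : (1 : ℝ) ≤ C₀ := by exact_mod_cast hC₀
  have hΛ : 1 < Λ := by rw [hΛdef]; linarith only [hC₀']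
  have hΛ0 : 0 < Λ := by linarith only [hΛ]
  have hDτ : 1 ≤ Dτ := by
    have h1 : (1 : ℕ) ≤ T :=
      le_trans (Nat.mul_pos hc₃ (shapeVal_pos fun i => Nat.mul_pos two_pos (hZ i))) hTZ
    simpa using hD 1 one_ne_zero h1
  have hBr : (0 : ℝ) < shapeCount c₁ c₂ c₃ X Y Z := by exact_mod_cast hB0
  have he0 : (0 : ℝ) ≤ (e : ℝ) := Nat.cast_nonneg _
  have hJ1 : (1 : ℝ) ≤ (J : ℝ) := by exact_mod_cast hJ
  have hdd : ((J + e : ℕ) : ℝ) = (J : ℝ) + (e : ℝ) := Nat.cast_add J e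
  have hlD0 : 0 ≤ Real.logb Λ Dτ := Real.logb_nonneg hΛ (by exact_mod_cast hDτ)
  have hV2pos : 0 < shapeVal (fun _ : Fin (J + e) => 2) := shapeVal_pos fun _ => two_pos
  have hlV0 : 0 ≤ Real.logb Λ ((shapeVal (fun _ : Fin (J + e) => 2) : ℕ) : ℝ) :=
    Real.logb_nonneg hΛ (by exact_mod_cast Nat.one_le_iff_ne_zero.mpr hV2pos.ne')
  obtain ⟨hl20, hl27, hl48, hl114⟩ : 0 ≤ Real.logb Λ 2 ∧ 0 ≤ Real.logb Λ 27 ∧ 0 ≤ Real.logb Λ 48 ∧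
      0 ≤ Real.logb Λ 114 := by
    refine ⟨?_, ?_, ?_, ?_⟩ <;> exact Real.logb_nonneg hΛ (by norm_num)
  have hl24 : 0 ≤ Real.logb Λ (24 * (J : ℝ) * ((J : ℝ) + 1)) :=
    Real.logb_nonneg hΛ (by nlinarith only [hJ1])
  have hlP0 : 0 ≤ Real.logb Λ P₀ := Real.logb_nonneg hΛ hP₀
  obtain ⟨m, hmdef⟩ : ∃ m : ℝ, max (t - s₀) 0 = m := ⟨_, rfl⟩
  have hmax0 : 0 ≤ m := by rw [← hmdef]; exact le_max_right _ _
  have hmax1 : t - s₀ ≤ m := by rw [← hmdef]; exact le_max_left _ _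
  have hσ' : σ = (12 * ((J : ℝ) + e) + 3 * J + 10) * Real.logb Λ Dτ + ((J : ℝ) ^ 2 + J + 10) * Real.logb Λ 2 +
      Real.logb Λ ((shapeVal (fun _ : Fin (J + e) => 2) : ℕ) : ℝ) + Real.logb Λ 27 + Real.logb Λ 48 +
      Real.logb Λ 114 + Real.logb Λ (24 * (J : ℝ) * ((J : ℝ) + 1)) + Real.logb Λ P₀ + m := by
    rw [← hσdef, recordSlack, hmdef, hdd]
  have hKD0 : 0 ≤ (12 * ((J : ℝ) + e) + 3 * J + 10) * Real.logb Λ Dτ :=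
    mul_nonneg (by linarith only [he0, hJ1]) hlD0
  have hK20 : 0 ≤ ((J : ℝ) ^ 2 + J + 10) * Real.logb Λ 2 := mul_nonneg (by positivity) hl20
  have hK2 : Real.logb Λ 2 ≤ ((J : ℝ) ^ 2 + J + 10) * Real.logb Λ 2 :=
    le_mul_of_one_le_left hl20 (by nlinarith only [hJ1])
  have hσ0 : 0 ≤ σ := by rw [hσ']; linarith only [hKD0, hK20, hlV0, hl27, hl48, hl114, hl24, hlP0, hmax0]
  /- the first `J` coordinates `Fin.castAdd e k`, `k < J` -/
  have hcast1 : ∀ {k : Fin J}, 1 ≤ (k : ℕ) → 1 ≤ ((Fin.castAdd e k : Fin (J + e)) : ℕ) := fun hk => by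
    rwa [Fin.val_castAdd]
  have hkJ : ∀ k : Fin J, ((k : ℕ) : ℝ) + 1 ≤ (J : ℝ) := fun k => by exact_mod_cast Nat.succ_le_of_lt k.is_lt
  /- the LP variables: exponents `α, β, γ`, totals `A, B, C`, `D`, deficits `da, db, dc`; the structure -/
  obtain ⟨α, hα⟩ : ∃ f : Fin (J + e) → ℝ, expo Λ X = f := ⟨_, rfl⟩
  obtain ⟨β, hβ⟩ : ∃ f : Fin (J + e) → ℝ, expo Λ Y = f := ⟨_, rfl⟩
  obtain ⟨γ, hγ⟩ : ∃ f : Fin (J + e) → ℝ, expo Λ Z = f := ⟨_, rfl⟩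
  obtain ⟨A, hA⟩ : ∃ r : ℝ, ∑ i, α i = r := ⟨_, rfl⟩
  obtain ⟨B, hB⟩ : ∃ r : ℝ, ∑ i, β i = r := ⟨_, rfl⟩
  obtain ⟨C, hC⟩ : ∃ r : ℝ, ∑ i, γ i = r := ⟨_, rfl⟩
  obtain ⟨D, hDn⟩ : ∃ r : ℝ, Real.logb Λ (shapeCount c₁ c₂ c₃ X Y Z) = r := ⟨_, rfl⟩
  obtain ⟨da, hLX⟩ : ∃ r : ℝ, Real.logb Λ ((c₁ * shapeVal X : ℕ) : ℝ) = 1 - r := ⟨_, (sub_sub_cancel 1 _).symm⟩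
  obtain ⟨db, hLY⟩ : ∃ r : ℝ, Real.logb Λ ((c₂ * shapeVal Y : ℕ) : ℝ) = 1 - r := ⟨_, (sub_sub_cancel 1 _).symm⟩
  obtain ⟨dc, hLZ⟩ : ∃ r : ℝ, Real.logb Λ ((c₃ * shapeVal Z : ℕ) : ℝ) = 1 - r := ⟨_, (sub_sub_cancel 1 _).symm⟩
  have hLrad : radExp Λ X Y Z = A + B + C := by
    rw [radExp, sum_add_distrib, sum_add_distrib, hα, hβ, hγ, hA, hB, hC]
  have hdefic : deficiency Λ c₁ c₂ c₃ X Y Z = da + db + dc := by rw [deficiency, hLX, hLY, hLZ]; ring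
  obtain ⟨hα0, hTa, hda0, hda1, hWa⟩ := term_facts_castAdd hc₁ hX hΛ hΛdef hvX hα hA hLX
  obtain ⟨hβ0, hTb, hdb0, hdb1, hWb⟩ := term_facts_castAdd hc₂ hY hΛ hΛdef hvY hβ hB hLY
  obtain ⟨hγ0, hTc, hdc0, -, hWc⟩ := term_facts_castAdd hc₃ hZ hΛ hΛdef hvZ hγ hC hLZ
  -- `dc ≤ σ`: `C₀ ≤ V₂ · c₃ shapeVal Z` and `log_Λ C₀ = 1 − log_Λ 2`
  have hdcσ : dc ≤ σ := by
    have h3 : Real.logb Λ (C₀ : ℝ) ≤ Real.logb Λ ((shapeVal (fun _ : Fin (J + e) => 2) : ℕ) : ℝ) +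
        Real.logb Λ ((c₃ * shapeVal Z : ℕ) : ℝ) := by
      rw [← logb_natMul hV2pos (Nat.mul_pos hc₃ (shapeVal_pos hZ))]
      exact logb_natMono hΛ (by omega) hC₀le
    have h4 : Real.logb Λ (C₀ : ℝ) = 1 - Real.logb Λ 2 := by
      have : (C₀ : ℝ) = Λ / 2 := by rw [hΛdef]; ring
      rw [this, Real.logb_div hΛ0.ne' two_ne_zero, Real.logb_self_eq_one hΛ]
    rw [hLZ] at h3
    linarith only [h3, h4, hσ', hKD0, hK2, hlV0, hl27, hl48, hl114, hl24, hlP0, hmax0]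
  /- the radical: `A + B + C = log_Λ ∏ XᵢYᵢZᵢ ≤ t ≤ s₀ + (t − s₀)₊` -/
  have hL : A + B + C ≤ s₀ + σ := by
    have hp : ∀ i, (0 : ℝ) < X i ∧ (0 : ℝ) < Y i ∧ (0 : ℝ) < Z i := fun i =>
      ⟨by exact_mod_cast hX i, by exact_mod_cast hY i, by exact_mod_cast hZ i⟩
    have hpos : ∀ i, (0 : ℝ) < (X i : ℝ) * Y i * Z i := fun i => by obtain ⟨h1, h2, h3⟩ := hp i; positivity
    have hlog := Real.logb_le_logb_of_le hΛ (prod_pos fun i _ => hpos i) hP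
    rw [Real.logb_rpow hΛ0 hΛ.ne', Real.logb_prod _ _ fun i _ => (hpos i).ne'] at hlog
    have hsum : ∑ i, Real.logb Λ ((X i : ℝ) * Y i * Z i) = A + B + C := by
      rw [← hLrad, radExp]
      refine sum_congr rfl fun i _ => ?_
      obtain ⟨h1, h2, h3⟩ := hp i
      rw [Real.logb_mul (by positivity) h3.ne', Real.logb_mul h1.ne' h2.ne']; rfl
    linarith only [hlog, hsum, hmax1, hσ', hKD0, hK20, hlV0, hl27, hl48, hl114, hl24, hlP0]
  /- the trivial family -/
  obtain ⟨hT1, hT2, hT3⟩ := trivial_linear hc₁ hc₂ hc₃ hX hY hZ hTX hTY hTZ hD hΛ hB0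
  have hd1 : ((J : ℝ) + (e : ℝ)) * Real.logb Λ Dτ ≤ (12 * ((J : ℝ) + e) + 3 * J + 10) * Real.logb Λ Dτ :=
    mul_le_mul_of_nonneg_right (by linarith only [he0, hJ1]) hlD0
  have h_T_ab : D ≤ A + B + σ := by
    rw [hα, hβ, hA, hB, hDn, hdd] at hT1
    linarith only [hT1, hd1, hσ', hK20, hlV0, hl27, hl48, hl114, hl24, hlP0, hmax0]
  have h_T_ac : D ≤ A + C + σ := by
    rw [hα, hγ, hA, hC, hDn, hdd] at hT2
    linarith only [hT2, hd1, hσ', hK20, hlV0, hl27, hl48, hl114, hl24, hlP0, hmax0]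
  have h_T_bc : D ≤ B + C + σ := by
    rw [hβ, hγ, hB, hC, hDn, hdd] at hT3
    linarith only [hT3, hd1, hσ', hK20, hlV0, hl27, hl48, hl114, hl24, hlP0, hmax0]
  /- the determinant family at the coordinates `Fin.castAdd e k`, `1 ≤ k < J` -/
  have hDt : ∀ k : Fin J, 1 ≤ (k : ℕ) →
      D ≤ A + B + C - (α (Fin.castAdd e k) + β (Fin.castAdd e k) + γ (Fin.castAdd e k)) + σ ∨
        D ≤ A + B + C - 1 + ((((k : ℕ) : ℝ) - 1) * (α (Fin.castAdd e k) + β (Fin.castAdd e k) +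
          γ (Fin.castAdd e k)) + (da + db + dc)) / 3 + σ := by
    intro k hk
    have h := det_linear hc₁ hc₂ hc₃ hX hY hZ hDτ hΛ hB0 (Fin.castAdd e k) (hdet (Fin.castAdd e k) (hcast1 hk))
    rw [hLrad, hdefic, hDn, hα, hβ, hγ, Fin.val_castAdd] at h
    have hprod : (((k : ℕ) : ℝ) + 1) * (((k : ℕ) : ℝ) + 2) ≤ (J : ℝ) * ((J : ℝ) + 1) :=
      mul_le_mul (hkJ k) (by linarith only [hkJ k]) (by positivity) (by linarith only [hJ1])
    have hl : Real.logb Λ (24 * ((((k : ℕ) : ℝ) + 1) * (((k : ℕ) : ℝ) + 2))) ≤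
        Real.logb Λ (24 * (J : ℝ) * ((J : ℝ) + 1)) :=
      Real.logb_le_logb_of_le hΛ (by positivity) (by linarith only [hprod])
    have hk' : (3 * ((k : ℕ) : ℝ) + 6) * Real.logb Λ Dτ ≤ (12 * ((J : ℝ) + e) + 3 * J + 10) * Real.logb Λ Dτ :=
      mul_le_mul_of_nonneg_right (by linarith only [hkJ k, he0, hJ1]) hlD0
    exact h.imp (fun h => by linarith only [h, hl, hk', hσ', hK20, hlV0, hl27, hl48, hl114, hlP0, hmax0])
      fun h => by linarith only [h, hl, hk', hσ', hK20, hlV0, hl27, hl48, hl114, hlP0, hmax0]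
  /- the Fourier family: saved finsets mapped along `Fin.castAdd e` -/
  have hmapd : ∀ {S : Finset (Fin J)} {n : ℕ}, (∀ k ∈ S, n ∣ (k : ℕ) + 1) →
      ∀ i ∈ S.map (Fin.castAddEmb e), n ∣ (i : ℕ) + 1 := by
    intro S n hS i hi
    rw [mem_map] at hi
    obtain ⟨k, hk, rfl⟩ := hi
    rw [Fin.castAddEmb_apply, Fin.val_castAdd]
    exact hS k hk
  have hF : ∀ (SU SV SW : Finset (Fin J)) (eU eV eW : ℕ), 2 ≤ eU → 2 ≤ eV → 2 ≤ eW →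
      (∀ k ∈ SU, eU ∣ (k : ℕ) + 1) → (∀ k ∈ SV, eV ∣ (k : ℕ) + 1) → (∀ k ∈ SW, eW ∣ (k : ℕ) + 1) →
      ∑ k ∈ SU, α (Fin.castAdd e k) + ∑ k ∈ SV, β (Fin.castAdd e k) + ∑ k ∈ SW, γ (Fin.castAdd e k) ≤
        4 * (A + B + C) - 6 * D + σ := by
    intro SU SV SW eU eV eW heU heV heW hSU hSV hSW
    have h := fourier_linear hc₁ hc₂ hc₃ hX hY hZ hTX hTY hTZ hD hΛ hB0 (SU.map (Fin.castAddEmb e))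
      (SV.map (Fin.castAddEmb e)) (SW.map (Fin.castAddEmb e)) heU heV heW (hmapd hSU) (hmapd hSV) (hmapd hSW)
    rw [hdd, hα, hβ, hγ, hA, hB, hC, hDn] at h
    simp only [sum_map, Fin.castAddEmb_apply] at h
    have h3 : (12 * ((J : ℝ) + e) + 3) * Real.logb Λ Dτ ≤ (12 * ((J : ℝ) + e) + 3 * J + 10) * Real.logb Λ Dτ :=
      mul_le_mul_of_nonneg_right (by linarith only [hJ1]) hlD0
    linarith only [h, h3, hσ', hK20, hlV0, hl48, hl114, hl24, hlP0, hmax0]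
  /- the subset geometry-of-numbers family: index finsets mapped along `Fin.castAdd e`, weights `≤ J(J+1)/2` each -/
  have hG : ∀ (I J' K : Finset (Fin J)),
      ∑ k ∈ I, α (Fin.castAdd e k) + ∑ k ∈ J', β (Fin.castAdd e k) + ∑ k ∈ K, γ (Fin.castAdd e k) ≤
          A + B + C - D + σ ∨
        1 - (∑ k ∈ I, ((k : ℕ) : ℝ) * α (Fin.castAdd e k) + ∑ k ∈ J', ((k : ℕ) : ℝ) * β (Fin.castAdd e k) +
          ∑ k ∈ K, ((k : ℕ) : ℝ) * γ (Fin.castAdd e k)) ≤ A + B + C - D + σ := by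
    intro I J' K
    have g := geometry_disjunction hc₁ hc₂ hc₃ hX hY hZ hTX hTY hTZ hD hΛ hB0 hC₀ hΛdef hC₀le
      (I.map (Fin.castAddEmb e)) (J'.map (Fin.castAddEmb e)) (K.map (Fin.castAddEmb e)) le_rfl
    rw [hdd, hα, hβ, hγ, hA, hB, hC, hDn] at g
    simp only [sum_map, Fin.castAddEmb_apply, Fin.val_castAdd] at g
    have hI := sum_natCast_succ_le I
    have hJ' := sum_natCast_succ_le J'
    have h2 : (8 + ∑ k ∈ I, (((k : ℕ) : ℝ) + 1) + ∑ k ∈ J', (((k : ℕ) : ℝ) + 1)) * Real.logb Λ 2 ≤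
        ((J : ℝ) ^ 2 + J + 10) * Real.logb Λ 2 :=
      mul_le_mul_of_nonneg_right (by linarith only [hI, hJ']) hl20
    have h3d : 3 * ((J : ℝ) + e) * Real.logb Λ Dτ ≤ (12 * ((J : ℝ) + e) + 3 * J + 10) * Real.logb Λ Dτ :=
      mul_le_mul_of_nonneg_right (by linarith only [he0, hJ1]) hlD0
    exact g.imp (fun g => by linarith only [g, h2, h3d, hσ', hl27, hl48, hl114, hl24, hlP0, hmax0])
      fun g => by linarith only [g, h2, h3d, hσ', hl27, hl48, hl114, hl24, hlP0, hmax0]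
  /- the square-root lattice family: hosts `x` (tool `Q_X`), `y` (`Q_X` on the swapped datum), `z` (`Q_Z`), host
  finsets mapped along `Fin.castAdd e`; the loss `(d + k + 2) log Dτ + log 114` at `k < J` is `≤ σ` -/
  have hQσ : ∀ {k : Fin J} {L1 L2 : ℝ},
      (D ≤ L1 + (((J : ℝ) + e + (k : ℕ) + 2) * Real.logb Λ Dτ + Real.logb Λ 114) ∨
        D ≤ L2 + (((J : ℝ) + e + (k : ℕ) + 2) * Real.logb Λ Dτ + Real.logb Λ 114)) →
      D ≤ L1 + σ ∨ D ≤ L2 + σ := by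
    intro k L1 L2 h
    have h9 : ((J : ℝ) + e + (k : ℕ) + 2) * Real.logb Λ Dτ ≤ (12 * ((J : ℝ) + e) + 3 * J + 10) * Real.logb Λ Dτ :=
      mul_le_mul_of_nonneg_right (by linarith only [he0, hJ1, hkJ k]) hlD0
    exact h.imp (fun h => by linarith only [h, h9, hσ', hK20, hlV0, hl27, hl48, hl24, hlP0, hmax0])
      fun h => by linarith only [h, h9, hσ', hK20, hlV0, hl27, hl48, hl24, hlP0, hmax0]
  have hQa : ∀ (H : Finset (Fin J)) (k : Fin J), 1 ≤ (k : ℕ) →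
      D ≤ A + B + C - (1 - da) + ∑ j ∈ H, ((j : ℕ) : ℝ) * α (Fin.castAdd e j) + σ ∨
        D ≤ A + B + C - (∑ j ∈ H, α (Fin.castAdd e j) + β (Fin.castAdd e k) + γ (Fin.castAdd e k)) + σ := by
    intro H k hk
    have q := sqrtLattice_linear hc₁ hX hY hZ hDτ hΛ hBr (H.map (Fin.castAddEmb e)) (Fin.castAdd e k)
      (hQX hc₁ hc₂ hc₃ X Y Z hX hY hZ hTX hTY hTZ hD (H.map (Fin.castAddEmb e)) (Fin.castAdd e k) (hcast1 hk))
    rw [hα, hβ, hγ, hA, hB, hC, hDn, hLX, hdd] at q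
    simp only [sum_map, Fin.castAddEmb_apply, Fin.val_castAdd] at q
    exact hQσ q
  have hBr' : (0 : ℝ) < shapeCount c₂ c₁ c₃ Y X Z := by rw [← shapeCount_swap c₁ c₂ c₃ X Y Z]; exact hBr
  have hQb : ∀ (H : Finset (Fin J)) (k : Fin J), 1 ≤ (k : ℕ) →
      D ≤ A + B + C - (1 - db) + ∑ j ∈ H, ((j : ℕ) : ℝ) * β (Fin.castAdd e j) + σ ∨
        D ≤ A + B + C - (∑ j ∈ H, β (Fin.castAdd e j) + α (Fin.castAdd e k) + γ (Fin.castAdd e k)) + σ := by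
    intro H k hk
    have q := sqrtLattice_linear hc₂ hY hX hZ hDτ hΛ hBr' (H.map (Fin.castAddEmb e)) (Fin.castAdd e k)
      (hQX hc₂ hc₁ hc₃ Y X Z hY hX hZ hTY hTX hTZ hD (H.map (Fin.castAddEmb e)) (Fin.castAdd e k) (hcast1 hk))
    rw [← shapeCount_swap c₁ c₂ c₃ X Y Z, hα, hβ, hγ, hA, hB, hC, hDn, hLY, hdd] at q
    simp only [sum_map, Fin.castAddEmb_apply, Fin.val_castAdd] at q
    exact (hQσ q).imp (fun h => by linarith only [h]) fun h => by linarith only [h]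
  have hQc : ∀ (H : Finset (Fin J)) (k : Fin J), 1 ≤ (k : ℕ) →
      D ≤ A + B + C - (1 - dc) + ∑ j ∈ H, ((j : ℕ) : ℝ) * γ (Fin.castAdd e j) + σ ∨
        D ≤ A + B + C - (∑ j ∈ H, γ (Fin.castAdd e j) + α (Fin.castAdd e k) + β (Fin.castAdd e k)) + σ := by
    intro H k hk
    have hq' := hQZ hc₁ hc₂ hc₃ X Y Z hX hY hZ hTX hTY hTZ hD (H.map (Fin.castAddEmb e)) (Fin.castAdd e k)
      (hcast1 hk)
    rw [← mul_rotate (subBox (H.map (Fin.castAddEmb e)) Z).card] at hq'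
    have q := sqrtLattice_linear hc₃ hZ hX hY hDτ hΛ hBr (H.map (Fin.castAddEmb e)) (Fin.castAdd e k) hq'
    rw [hα, hβ, hγ, hA, hB, hC, hDn, hLZ, hdd] at q
    simp only [sum_map, Fin.castAddEmb_apply, Fin.val_castAdd] at q
    exact (hQσ q).imp (fun h => by linarith only [h]) fun h => by linarith only [h]
  /- the linear programme -/
  rw [hDn]
  exact hlp (fun k => α (Fin.castAdd e k)) (fun k => β (Fin.castAdd e k)) (fun k => γ (Fin.castAdd e k)) A B C D
    da db dc σ (fun k => hα0 (Fin.castAdd e k)) (fun k => hβ0 (Fin.castAdd e k)) (fun k => hγ0 (Fin.castAdd e k))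
    hTa hTb hTc hWa hda0 hda1 hWb hdb0 hdb1 hWc hdc0 hdcσ hσ0 hσm hL h_T_ab h_T_ac h_T_bc hDt hF hG hQa hQb hQc

end Summit.ABC.ABC.Theorems.MazurKaneLaw

end
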